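import Literature.Probability.Percolation.TriLowestCrossing
import Literature.Probability.Percolation.ArmSeparationNonvacuity
import Literature.Probability.Percolation.TriCrossingsMeet
import Literature.Probability.Percolation.TriHexLemma
import Literature.Probability.Percolation.TriAnnulusCircuit
import HarnessLib

/-!
# The boundary trapezoid of a hexagonal annulus as a `JDomain` (cut and duality properties)

Topic: Probability / Percolation; family `crit-perc` (critical site percolation on the triangular
lattice `𝕋 = triGraph`). A brick of the discharge of the named fact
`Literature.Probability.Percolation.Nolin2008_twoArm_separation` (`ArmSeparation.lean`; Nolin 2008,
Thm. 11 [arXiv 0711.4948: Thm. 10], arm separation, for `j = 2`). The abstract lowest-crossing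
toolkit `JDomain` of `TriLowestCrossing.lean` (Kesten 1982, §2.3, Prop. 2.3: crossings from a start
set `F` to a tip arc `J`, the region `above` a crossing, the lowest open crossing `lowest` and the
exploration sequence `lowestSeq`, all under the two planar hypotheses `CutProp` and `DualProp`)
asks for the two hypotheses "to be established for the concrete regions elsewhere (by reduction
to the Hex lemma `tri_hex` and to `PathIn.tri_crossings_meet`)". This file does so for the region
in which the separation argument for the OUTER extremities runs on the hexagonal annuli
`Λ_{2M} ∖ Λ_M` of `armEvent` (`Λ_n = triBall n`, `|·| = triNorm`; Nolin 2008, §4.4, Fig. 7,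
`U^{1,ext}`):

* `trapD M` — the **trapezoid** `T = {v : M < v₀ ≤ 2M, |v| ≤ 2M}` behind side `0` of the hexagon
  `∂Λ_{2M}` (`mem_trapD_iff_triNorm`), with its sides `trapI` (inner, `v₀ = M + 1`), `trapB`
  (bottom, `v₁ = -2M`, on side `5` of `∂Λ_{2M}`), `trapO` (outer, `v₀ = 2M`, side `0`) and `trapU`
  (top, `v₀ + v₁ = 2M`, on side `1`), as `Finset`s. An arm of `armEvent` landing on side `0`
  (cut at its first visit to `∂Λ_{2M}`) has its final segment — after its last visit to
  `{v₀ ≤ M}` — inside `T`, from `trapI` to `trapO`: the sides `trapB`, `trapU` lie on `∂Λ_{2M}`.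
* `trapDomain M : JDomain` — `D = trapD`, tip arc `J = trapO` ordered by the height `v ↦ v₁`,
  start set `F = trapI`, lower arc `Bt = trapB`, upper arc `Tp = trapU`.
* `trap_blocks`, `trapDomain_cutProp` — **(H1) crossings cut the trapezoid**: a `𝕋`-path of `T`
  avoiding a `trapI–trapO` path `c` (meeting `trapO` only at its tip `z`) cannot join a
  bottom-type site (`trapB`, or `trapO` strictly below `z`) to a top-type one (`trapU`, or `trapO`
  strictly above `z`): extended straight down/up along `trapO` and northwards through the exterior
  triangle above `trapU` it would be a bottom–top crossing of the bounding parallelogram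
  `[M+1, 2M] × [-2M, M-1]` disjoint from the left–right crossing `c` (`PathIn.tri_crossings_meet`;
  Kesten 1982, §2.2).
* `trapDomain_dualProp` — **(H2) duality**: for every `S ⊆ T`, either `S` contains a path from
  `trapI` to `trapO` or `T ∖ S` contains a path from `trapB` to `trapU` (the Hex lemma `tri_hex`,
  Bollobás–Riordan 2006, Ch. 5, Lemma 7, in the bounding parallelogram, the exterior triangle
  counting as "not in `S`": a bottom–top path avoiding `S` leaves `T` only through `trapU`).
* Boundary bookkeeping used by the fence construction (`ArmSeparationFrame.lean`): the sites of
  `T` on `∂Λ_{2M}` are those of `trapO ∪ trapB ∪ trapU` (`triNorm_eq_iff_mem_sides`); every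
  boundary site other than the tip is bottom-type or top-type (`sType_or_nType`); a boundary site
  with an exterior neighbour strictly above the row of the tip is top-type
  (`nType_of_adj_exterior`).

Hence `lowest`, `lowest_congr`, `lowestSeq`, `exists_lowestSeq_inter_nonempty`, … of
`TriLowestCrossing.lean` apply to `trapDomain M` (`1 ≤ M`).

## References

* H. Kesten, *Percolation theory for mathematicians*, Birkhäuser (1982), §2.2 (paths crossing a
  rectangle meet), §2.3, Prop. 2.3 (lowest crosscut). [KestenPTM1982]
* P. Nolin, *Near-critical percolation in two dimensions*, Electron. J. Probab. 13 (2008), §4.4,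
  Lemma 15 and proof of Thm. 11 [arXiv 0711.4948: Lemma 14, Thm. 10]. [Nolin2008]
* B. Bollobás, O. Riordan, *Percolation*, CUP (2006), Ch. 5, Lemma 7 (Hex lemma). [BollobasRiordan2006]
* H. Kesten, *Scaling relations for 2D-percolation*, Comm. Math. Phys. 109 (1987), Lemma 2.
  [Kesten1987]

Mathlib: `Finset.Icc` on `Fin 2 → ℤ`, `Finset.filter`; no percolation or planar topology.
Tree: `JDomain` and its API (`TriLowestCrossing.lean`), `PathIn` (`SitePaths.lean`), `tri_hex`,
`triGraph_adj_coord` (`TriHexLemma.lean`), `PathIn.tri_crossings_meet`, `triGraph_adj_cases`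
(`TriCrossingsMeet.lean`), `pathIn_shift` (`TriRSWChaining.lean`), `triNorm_eq_max`
(`TriAnnulusCircuit.lean`), `triNorm_le_triNorm_add_one_of_adj` (`ArmEventsProofs.lean`),
`pathIn_vSegment_up` (`ArmSeparationNonvacuity.lean`), `mem_rectangle_iff`, `leftSide` &c.
(`Crossings.lean`).
-/

noncomputable section

open Set

namespace Literature.Probability.Percolation

open LatticeModels

/-! ### The trapezoid and its sides -/

/-- The **boundary trapezoid** `T = {v : M < v₀ ≤ 2M, -2M ≤ v₁, v₀ + v₁ ≤ 2M}` behind the right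
side of the hexagon `∂Λ_{2M}`; equivalently `{v : M < v₀, |v|_𝕋 ≤ 2M}` (`mem_trapD_iff_triNorm`).
(The boundary piece of the last dyadic annulus in which Kesten's lowest-crossing argument runs:
Nolin 2008, §4.4, Fig. 7, `U^{1,ext}`; Kesten 1987, Lemma 2.) [cite: Nolin2008, §4.4 (U-shaped regions, arXiv 0711.4948)] -/
def trapD (M : ℕ) : Finset (Site 2) :=
  (Finset.Icc (![(M : ℤ) + 1, -(2 * (M : ℤ))] : Site 2) ![2 * (M : ℤ), (M : ℤ) - 1]).filter
    fun v => v 0 + v 1 ≤ 2 * M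

/-- Membership in the trapezoid, unfolded. [cite: Nolin2008, §4.4 (U-shaped regions, arXiv 0711.4948)] -/
@[simp] theorem mem_trapD {M : ℕ} {v : Site 2} :
    v ∈ trapD M ↔ (M : ℤ) < v 0 ∧ v 0 ≤ 2 * M ∧ -(2 * (M : ℤ)) ≤ v 1 ∧ v 0 + v 1 ≤ 2 * M := by
  simp only [trapD, Finset.mem_filter, Finset.mem_Icc, Pi.le_def, Fin.forall_fin_two,
    Matrix.cons_val_zero, Matrix.cons_val_one]
  omega

/-- The trapezoid is `{M < v₀} ∩ Λ_{2M}`. [cite: Nolin2008, §4.4 (U-shaped regions, arXiv 0711.4948)] -/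
theorem mem_trapD_iff_triNorm {M : ℕ} {v : Site 2} :
    v ∈ trapD M ↔ (M : ℤ) < v 0 ∧ triNorm v ≤ 2 * M := by
  rw [mem_trapD, triNorm_eq_max]
  constructor
  · rintro ⟨h1, h2, h3, h4⟩
    refine ⟨h1, ?_⟩
    simp only [max_le_iff]
    omega
  · rintro ⟨h1, h2⟩
    simp only [max_le_iff] at h2
    omega

/-- Sites of `Λ_{2M}` with `v₀ > M` are in the trapezoid. [folklore] -/
theorem mem_trapD_of_triNorm_le {M : ℕ} {v : Site 2} (h0 : (M : ℤ) < v 0) (hn : triNorm v ≤ 2 * M) :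
    v ∈ trapD M :=
  mem_trapD_iff_triNorm.2 ⟨h0, hn⟩

/-- The **inner side** `{v₀ = M + 1}` of the trapezoid (the start set of crossings). [cite: Nolin2008, §4.4 (U-shaped regions, arXiv 0711.4948)] -/
def trapI (M : ℕ) : Finset (Site 2) := (trapD M).filter fun v => v 0 = M + 1

/-- The **outer side** of the trapezoid (the tip arc): side `0` of `∂Λ_{2M}`, `{v₀ = 2M}`. [cite: Nolin2008, §4.4 (U-shaped regions, arXiv 0711.4948)] -/
def trapO (M : ℕ) : Finset (Site 2) := (trapD M).filter fun v => v 0 = 2 * M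

/-- The **bottom side** `{v₁ = -2M}` of the trapezoid (on side `5` of `∂Λ_{2M}`). [cite: Nolin2008, §4.4 (U-shaped regions, arXiv 0711.4948)] -/
def trapB (M : ℕ) : Finset (Site 2) := (trapD M).filter fun v => v 1 = -(2 * (M : ℤ))

/-- The **top side** `{v₀ + v₁ = 2M}` of the trapezoid (on side `1` of `∂Λ_{2M}`). [cite: Nolin2008, §4.4 (U-shaped regions, arXiv 0711.4948)] -/
def trapU (M : ℕ) : Finset (Site 2) := (trapD M).filter fun v => v 0 + v 1 = 2 * M

/-- Membership in the inner side, unfolded. [folklore] -/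
@[simp] theorem mem_trapI {M : ℕ} {v : Site 2} : v ∈ trapI M ↔ v ∈ trapD M ∧ v 0 = M + 1 := by
  simp [trapI]

/-- Membership in the outer side, unfolded. [folklore] -/
@[simp] theorem mem_trapO {M : ℕ} {v : Site 2} : v ∈ trapO M ↔ v ∈ trapD M ∧ v 0 = 2 * M := by
  simp [trapO]

/-- Membership in the bottom side, unfolded. [folklore] -/
@[simp] theorem mem_trapB {M : ℕ} {v : Site 2} : v ∈ trapB M ↔ v ∈ trapD M ∧ v 1 = -(2 * (M : ℤ)) := by
  simp [trapB]

/-- Membership in the top side, unfolded. [folklore] -/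
@[simp] theorem mem_trapU {M : ℕ} {v : Site 2} : v ∈ trapU M ↔ v ∈ trapD M ∧ v 0 + v 1 = 2 * M := by
  simp [trapU]

/-- Coordinates of an outer-side site: `v₀ = 2M`, `-2M ≤ v₁ ≤ 0`. [folklore] -/
theorem trapO_coord {M : ℕ} {v : Site 2} (hv : v ∈ trapO M) : v 0 = 2 * M ∧ -(2 * (M : ℤ)) ≤ v 1 ∧ v 1 ≤ 0 := by
  rw [mem_trapO, mem_trapD] at hv
  omega

/-- The outer side in coordinates (`1 ≤ M`). [folklore] -/
theorem mem_trapO_iff {M : ℕ} (hM : 1 ≤ M) {v : Site 2} :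
    v ∈ trapO M ↔ v 0 = 2 * M ∧ -(2 * (M : ℤ)) ≤ v 1 ∧ v 1 ≤ 0 := by
  refine ⟨trapO_coord, fun h => ?_⟩
  rw [mem_trapO, mem_trapD]
  have : (1 : ℤ) ≤ M := by exact_mod_cast hM
  omega

/-- A site of the trapezoid has `|v| = 2M` iff it lies on one of the three sides `trapO`, `trapB`,
`trapU` carried by `∂Λ_{2M}`. [folklore] -/
theorem triNorm_eq_iff_mem_sides {M : ℕ} {v : Site 2} (hv : v ∈ trapD M) :
    triNorm v = 2 * M ↔ v ∈ trapO M ∨ v ∈ trapB M ∨ v ∈ trapU M := by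
  have hv' := hv
  rw [mem_trapD] at hv'
  rw [mem_trapO, mem_trapB, mem_trapU, triNorm_eq_max]
  simp only [hv, true_and]
  constructor
  · intro h
    have h' : (2 * (M : ℤ)) ≤
        max (max (v 0) (-v 0)) (max (max (v 1) (-v 1)) (max (v 0 + v 1) (-(v 0 + v 1)))) := h.ge
    simp only [le_max_iff] at h'
    clear h
    omega
  · intro h
    apply le_antisymm
    · exact (triNorm_eq_max v) ▸ (mem_trapD_iff_triNorm.1 hv).2
    · simp only [le_max_iff]
      omega

/-- A site of the trapezoid adjacent to a site outside `Λ_{2M}` lies on `∂Λ_{2M}`. [folklore] -/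
theorem triNorm_eq_of_adj_exterior {M : ℕ} {v w : Site 2} (hv : v ∈ trapD M)
    (hw : 2 * (M : ℤ) < triNorm w) (h : triGraph.Adj v w) : triNorm v = 2 * M := by
  have h1 := (mem_trapD_iff_triNorm.1 hv).2
  have h2 := triNorm_le_triNorm_add_one_of_adj h
  omega

/-- Two sites of the outer side at the same height coincide. [folklore] -/
theorem eq_of_mem_trapO {M : ℕ} {v z : Site 2} (hv : v ∈ trapO M) (hz : z ∈ trapO M) (h : v 1 = z 1) : v = z := by
  have ev : v = ![v 0, v 1] := by ext j; fin_cases j <;> rfl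
  have ez : z = ![z 0, z 1] := by ext j; fin_cases j <;> rfl
  rw [ev, ez, h, (trapO_coord hv).1, (trapO_coord hz).1]

/-- Along an edge of `𝕋` the linear form `v₀ + v₁` changes by at most one. [folklore] -/
theorem add_le_add_add_one_of_adj {x y : Site 2} (h : triGraph.Adj x y) : y 0 + y 1 ≤ x 0 + x 1 + 1 := by
  rcases triGraph_adj_cases h with h | h | h | h | h | h <;> omega

/-! ### The trapezoid as a `JDomain` -/

/-- **The boundary trapezoid as a `JDomain`**: `D = trapD M`, tip arc `J = trapO M` (side `0` of
`∂Λ_{2M}`, where the arms land) ordered by the height `v ↦ v₁`, start set `F = trapI M`, lower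
reference arc `Bt = trapB M`, upper reference arc `Tp = trapU M` (Nolin 2008, §4.4: the region
`U^{1,ext}` of the last annulus with its marked boundary parts; Kesten 1982, §2.3). [cite: Nolin2008, §4.4 (arXiv 0711.4948: Lemma 14)] -/
def trapDomain (M : ℕ) : JDomain where
  D := trapD M
  J := trapO M
  F := trapI M
  Tp := trapU M
  Bt := trapB M
  ht := fun v => v 1
  J_subset := Finset.filter_subset _ _
  F_subset := Finset.filter_subset _ _
  Tp_subset := Finset.filter_subset _ _
  Bt_subset := Finset.filter_subset _ _
  ht_injOn := fun _ hv _ hz h => eq_of_mem_trapO hv hz h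

/-- The data of `trapDomain`, unfolded. [folklore] -/
@[simp] theorem trapDomain_D (M : ℕ) : (trapDomain M).D = trapD M := rfl

/-- The tip arc of `trapDomain`. [folklore] -/
@[simp] theorem trapDomain_J (M : ℕ) : (trapDomain M).J = trapO M := rfl

/-- The start set of `trapDomain`. [folklore] -/
@[simp] theorem trapDomain_F (M : ℕ) : (trapDomain M).F = trapI M := rfl

/-- The upper arc of `trapDomain`. [folklore] -/
@[simp] theorem trapDomain_Tp (M : ℕ) : (trapDomain M).Tp = trapU M := rfl

/-- The lower arc of `trapDomain`. [folklore] -/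
@[simp] theorem trapDomain_Bt (M : ℕ) : (trapDomain M).Bt = trapB M := rfl

/-- The height of `trapDomain`. [folklore] -/
@[simp] theorem trapDomain_ht (M : ℕ) (v : Site 2) : (trapDomain M).ht v = v 1 := rfl

/-- The part of the tip arc strictly below a tip, unfolded. [folklore] -/
@[simp] theorem mem_trapDomain_Jbelow {M : ℕ} {z v : Site 2} :
    v ∈ (trapDomain M).Jbelow z ↔ v ∈ trapO M ∧ v 1 < z 1 := by
  rw [JDomain.mem_Jbelow]; rfl

/-- The part of the tip arc strictly above a tip, unfolded. [folklore] -/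
@[simp] theorem mem_trapDomain_Jabove {M : ℕ} {z v : Site 2} :
    v ∈ (trapDomain M).Jabove z ↔ v ∈ trapO M ∧ z 1 < v 1 := by
  rw [JDomain.mem_Jabove]; rfl

/-! ### Bottom-type and top-type boundary sites -/

/-- **Every boundary site other than the tip is bottom-type (`Bt ∪ J_{<z}`) or top-type
(`Tp ∪ J_{>z}`).** [cite: KestenPTM1982, §2.3] -/
theorem sType_or_nType {M : ℕ} {v z : Site 2} (hv : v ∈ trapD M) (hn : triNorm v = 2 * M)
    (hz : z ∈ trapO M) (hne : v ≠ z) :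
    v ∈ (trapDomain M).Bt ∪ (trapDomain M).Jbelow z ∨ v ∈ (trapDomain M).Tp ∪ (trapDomain M).Jabove z := by
  simp only [Finset.mem_union, trapDomain_Bt, trapDomain_Tp, mem_trapDomain_Jbelow, mem_trapDomain_Jabove]
  rcases (triNorm_eq_iff_mem_sides hv).1 hn with hO | hB | hU
  · rcases lt_trichotomy (v 1) (z 1) with h | h | h
    · exact Or.inl (Or.inr ⟨hO, h⟩)
    · exact absurd (eq_of_mem_trapO hO hz h) hne
    · exact Or.inr (Or.inr ⟨hO, h⟩)
  · exact Or.inl (Or.inl hB)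
  · exact Or.inr (Or.inl hU)

/-- Top-type sites other than the tip lie strictly above the tip. [cite: KestenPTM1982, §2.3] -/
theorem row_lt_of_nType {M : ℕ} {v z : Site 2} (hz : z ∈ trapO M)
    (hv : v ∈ (trapDomain M).Tp ∪ (trapDomain M).Jabove z) (hne : v ≠ z) : z 1 < v 1 := by
  simp only [Finset.mem_union, trapDomain_Tp, mem_trapDomain_Jabove] at hv
  rcases hv with hU | ⟨-, h⟩
  · rw [mem_trapU, mem_trapD] at hU
    have hz' := trapO_coord hz
    by_contra hle
    have h0 : v 0 = 2 * M := by omega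
    have h1 : v 1 = z 1 := by omega
    have ev : v = ![v 0, v 1] := by ext j; fin_cases j <;> rfl
    have ez : z = ![z 0, z 1] := by ext j; fin_cases j <;> rfl
    exact hne (by rw [ev, ez, h0, h1, hz'.1])
  · exact h

/-- Bottom-type sites lie weakly below the tip. [cite: KestenPTM1982, §2.3] -/
theorem row_le_of_sType {M : ℕ} {v z : Site 2} (hz : z ∈ trapO M)
    (hv : v ∈ (trapDomain M).Bt ∪ (trapDomain M).Jbelow z) : v 1 ≤ z 1 := by
  simp only [Finset.mem_union, trapDomain_Bt, mem_trapDomain_Jbelow] at hv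
  rcases hv with hB | ⟨-, h⟩
  · rw [mem_trapB, mem_trapD] at hB
    have := trapO_coord hz
    omega
  · exact h.le

/-- **A boundary site, other than the tip, with an exterior neighbour strictly above the tip is
top-type** (the bottom side has no exterior neighbours above it, except at the bottom corner). [cite: KestenPTM1982, §2.3] -/
theorem nType_of_adj_exterior {M : ℕ} {v w z : Site 2} (hv : v ∈ trapD M) (hz : z ∈ trapO M) (hne : v ≠ z)
    (hw : 2 * (M : ℤ) < triNorm w) (hadj : triGraph.Adj v w) (hrow : z 1 < w 1) :
    v ∈ (trapDomain M).Tp ∪ (trapDomain M).Jabove z := by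
  have hn := triNorm_eq_of_adj_exterior hv hw hadj
  rcases sType_or_nType hv hn hz hne with hS | hN
  · exfalso
    have hv' := mem_trapD.1 hv
    have hz' := trapO_coord hz
    rw [triNorm_eq_max] at hw
    simp only [Finset.mem_union, trapDomain_Bt, mem_trapDomain_Jbelow] at hS
    rcases hS with hB | ⟨hO, hlt⟩
    · have hB1 := (mem_trapB.1 hB).2
      rcases triGraph_adj_cases hadj with h | h | h | h | h | h <;>
        · simp only [lt_max_iff] at hw
          omega
    · have hO' := trapO_coord hO
      rcases triGraph_adj_cases hadj with h | h | h | h | h | h <;> omega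
  · exact hN

/-! ### (H1) Crossings cut the trapezoid -/

/-- **A crossing from the inner side to the outer side blocks** (Kesten 1982, §2.2: two paths
crossing a rectangle in the two directions meet; here in the trapezoid `T`). Let `c` be a
`𝕋`-path inside `S ⊆ T` from a site of the inner side `trapI` to a site `z` of the outer side,
meeting `trapO` only at `z`. Then no `𝕋`-path of `T` avoiding `S` goes from a bottom-type site
(`trapB`, or `trapO` below `z`) to a top-type site (`trapU`, or `trapO` above `z`). Proof: extend
the second path straight down along the outer side and straight up (along the outer side, resp.
northwards through the exterior triangle above `trapU`) to a bottom–top crossing of the bounding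
parallelogram `[M+1, 2M] × [-2M, M-1]` still avoiding `S`, and apply
`PathIn.tri_crossings_meet`. [cite: KestenPTM1982, §2.2 (paths crossing a rectangle must intersect)] -/
theorem trap_blocks {M : ℕ} {S Q : Set (Site 2)} {a z p q : Site 2}
    (hS : S ⊆ ↑(trapD M)) (ha : a ∈ trapI M) (hz : z ∈ trapO M) (hSO : ∀ s ∈ S, s ∈ trapO M → s = z)
    (hc : PathIn triGraph S a z) (hQ : Q ⊆ ↑(trapD M)) (hQS : Disjoint Q S)
    (hp : p ∈ trapB M ∨ (p ∈ trapO M ∧ p 1 < z 1)) (hq : q ∈ trapU M ∨ (q ∈ trapO M ∧ z 1 < q 1))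
    (hpq : PathIn triGraph Q p q) : False := by
  -- the bounding parallelogram and the complement of `S` in it
  set A' : Set (Site 2) :=
    {v | ((M : ℤ) + 1 ≤ v 0 ∧ v 0 ≤ 2 * M ∧ -(2 * (M : ℤ)) ≤ v 1 ∧ v 1 ≤ M - 1) ∧ v ∉ S} with hA'
  have hbS : ∀ v ∈ S, (M : ℤ) + 1 ≤ v 0 ∧ v 0 ≤ 2 * M ∧ -(2 * (M : ℤ)) ≤ v 1 ∧ v 1 ≤ M - 1 := by
    intro v hv
    have := mem_trapD.1 (hS hv)
    omega
  have hbA' : ∀ v ∈ A', (M : ℤ) + 1 ≤ v 0 ∧ v 0 ≤ 2 * M ∧ -(2 * (M : ℤ)) ≤ v 1 ∧ v 1 ≤ M - 1 :=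
    fun v hv => hv.1
  have hQA' : Q ⊆ A' := by
    intro v hv
    have hvT := mem_trapD.1 (hQ hv)
    refine ⟨by omega, fun hvS => ?_⟩
    exact Set.disjoint_left.1 hQS hv hvS
  have hz' := trapO_coord hz
  -- outer-side sites other than `z` avoid `S`
  have hOS : ∀ v : Site 2, v ∈ trapO M → v 1 ≠ z 1 → v ∉ S := by
    intro v hv hne hvS
    exact hne (by rw [hSO v hvS hv])
  have hM1 : (M : ℤ) < 2 * M := by have := mem_trapD.1 (mem_trapO.1 hz).1; omega
  have hOmem : ∀ t : ℤ, -(2 * (M : ℤ)) ≤ t → t ≤ 0 → (![2 * (M : ℤ), t] : Site 2) ∈ trapO M := by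
    intro t h1 h2
    rw [mem_trapO, mem_trapD]
    simp
    omega
  -- lower extension: from a bottom-row site `p'` to `p` inside `A'`
  obtain ⟨p', hp'1, hpp'⟩ : ∃ p' : Site 2, p' 1 = -(2 * (M : ℤ)) ∧ PathIn triGraph A' p' p := by
    rcases hp with hpB | ⟨hpO, hpz⟩
    · exact ⟨p, (mem_trapB.1 hpB).2, PathIn.refl (hQA' hpq.left_mem)⟩
    · have hpO' := trapO_coord hpO
      refine ⟨![2 * (M : ℤ), -(2 * (M : ℤ))], rfl, ?_⟩
      have key := pathIn_vSegment_up (A := A') (x := 2 * (M : ℤ)) (t := -(2 * (M : ℤ)))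
        (p 1 + 2 * M).toNat (fun i hi => ?_)
      · have e : -(2 * (M : ℤ)) + ((p 1 + 2 * M).toNat : ℕ) = p 1 := by omega
        rw [e] at key
        have ep : (![2 * (M : ℤ), p 1] : Site 2) = p := by
          ext j; fin_cases j <;> simp [hpO'.1]
        rwa [ep] at key
      · have hi' : (i : ℤ) ≤ p 1 + 2 * M := by
          have := (Int.toNat_of_nonneg (by omega : (0 : ℤ) ≤ p 1 + 2 * M))
          omega
        refine ⟨?_, hOS _ (hOmem _ (by omega) (by omega)) ?_⟩
        · simp; omega
        · simp; omega
  -- upper extension: from `q` to a top-row site `q'` inside `A'`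
  obtain ⟨q', hq'1, hqq'⟩ : ∃ q' : Site 2, q' 1 = (M : ℤ) - 1 ∧ PathIn triGraph A' q q' := by
    rcases hq with hqU | ⟨hqO, hqz⟩
    · have hqU' := hqU
      rw [mem_trapU, mem_trapD] at hqU'
      refine ⟨![q 0, q 1 + (((M : ℤ) - 1 - q 1).toNat : ℕ)], ?_, ?_⟩
      · simp; omega
      · have key := pathIn_vSegment_up (A := A') (x := q 0) (t := q 1) (((M : ℤ) - 1 - q 1).toNat)
          (fun i hi => ?_)
        · have eq : (![q 0, q 1] : Site 2) = q := by ext j; fin_cases j <;> rfl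
          rwa [eq] at key
        · have hi' : (i : ℤ) ≤ (M : ℤ) - 1 - q 1 := by
            have := (Int.toNat_of_nonneg (by omega : (0 : ℤ) ≤ (M : ℤ) - 1 - q 1))
            omega
          rcases Nat.eq_zero_or_pos i with rfl | hi0
          · have eq : (![q 0, q 1 + ((0 : ℕ) : ℤ)] : Site 2) = q := by
              ext j; fin_cases j <;> simp
            rw [eq]
            exact hQA' hpq.right_mem
          · refine ⟨?_, fun hS' => ?_⟩
            · simp; omega
            · have := mem_trapD.1 (hS hS')
              simp at this
              omega
    · have hqO' := trapO_coord hqO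
      refine ⟨![2 * (M : ℤ), q 1 + (((M : ℤ) - 1 - q 1).toNat : ℕ)], ?_, ?_⟩
      · simp; omega
      · have key := pathIn_vSegment_up (A := A') (x := 2 * (M : ℤ)) (t := q 1) (((M : ℤ) - 1 - q 1).toNat)
          (fun i hi => ?_)
        · have eq : (![2 * (M : ℤ), q 1] : Site 2) = q := by
            ext j; fin_cases j <;> simp [hqO'.1]
          rwa [eq] at key
        · have hi' : (i : ℤ) ≤ (M : ℤ) - 1 - q 1 := by
            have := (Int.toNat_of_nonneg (by omega : (0 : ℤ) ≤ (M : ℤ) - 1 - q 1))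
            omega
          refine ⟨?_, fun hS' => ?_⟩
          · simp; omega
          · have hT := mem_trapD.1 (hS hS')
            simp at hT
            have hO : (![2 * (M : ℤ), q 1 + (i : ℕ)] : Site 2) ∈ trapO M := hOmem _ (by omega) (by omega)
            have := hSO _ hS' hO
            have h1 : (![2 * (M : ℤ), q 1 + (i : ℕ)] : Site 2) 1 = z 1 := by rw [this]
            simp at h1
            omega
  -- the two crossings of the parallelogram meet, inside `S` and outside `S`
  have ha0 : a 0 = (M : ℤ) + 1 := (mem_trapI.1 ha).2
  obtain ⟨w, hwS, hwA'⟩ := PathIn.tri_crossings_meet (L := (M : ℤ) + 1) (R := 2 * (M : ℤ))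
    (B := -(2 * (M : ℤ))) (T := (M : ℤ) - 1) hbS hbA' hc ha0 hz'.1 (hpp'.trans ((hpq.mono hQA').trans hqq'))
    hp'1 hq'1
  exact hwA'.2 hwS

/-- **(H1) for the trapezoid**: crossings of `trapDomain M` cut it (`JDomain.CutProp`), by
`trap_blocks` applied to the crossing (a connected set of sites containing an inner-side site and
meeting the outer side only at its tip). [cite: KestenPTM1982, §2.3] -/
theorem trapDomain_cutProp (M : ℕ) : (trapDomain M).CutProp := by
  intro c z hc s hs e he hpath
  obtain ⟨f, hfc, hfI⟩ := hc.exists_start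
  have hcz : PathIn triGraph (↑c : Set (Site 2)) f z := hc.conn f hfc z hc.tip_mem
  have hsub : (↑((trapDomain M).D \ c) : Set (Site 2)) ⊆ ↑(trapD M) := by
    intro v hv
    rw [Finset.coe_sdiff] at hv
    exact hv.1
  have hdisj : Disjoint (↑((trapDomain M).D \ c) : Set (Site 2)) ↑c := by
    rw [Finset.coe_sdiff]
    exact Set.disjoint_sdiff_left
  simp only [Finset.mem_union, trapDomain_Bt, trapDomain_Tp, mem_trapDomain_Jbelow, mem_trapDomain_Jabove] at hs he
  exact trap_blocks (fun v hv => hc.subset hv) hfI hc.tip_mem_J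
    (fun v hv hvO => hc.eq_tip v hv hvO) hcz hsub hdisj hs he hpath

/-! ### (H2) Duality in the trapezoid -/

/-- **(H2) for the trapezoid** (`1 ≤ M`): for every `S ⊆ T`, either `S` contains a `𝕋`-path from
`trapI` to `trapO`, or `T ∖ S` contains a `𝕋`-path from `trapB` to `trapU` (`JDomain.DualProp`).
Proof: the Hex lemma `tri_hex` in the bounding parallelogram `[M+1, 2M] × [-2M, M-1]` (translated
to `[0, M-1] × [0, 3M-1]`) for `S`: a left–right path of `S` is a `trapI–trapO` path; a bottom–top
path avoiding `S` starts on `trapB`, and it can leave `T` only through a site of `trapU` (the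
exterior triangle is `{v₀ + v₁ > 2M}` and `v₀ + v₁` moves by at most one per step), while if it
never leaves, its end on the top row is the corner of `trapI` and `trapU`. (Bollobás–Riordan
2006, Ch. 5, Lemma 7; Kesten 1982, §2.2.) [cite: BollobasRiordan2006, Ch. 5 Lemma 7] -/
theorem trapDomain_dualProp {M : ℕ} (hM : 1 ≤ M) : (trapDomain M).DualProp := by
  intro S hSD
  simp only [trapDomain_D, trapDomain_J, trapDomain_F, trapDomain_Tp, trapDomain_Bt] at hSD ⊢
  set v₀ : Site 2 := ![(M : ℤ) + 1, -(2 * (M : ℤ))] with hv₀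
  have hv0 : ∀ x : Site 2, (x + v₀) 0 = x 0 + (M + 1) := fun x => by simp [hv₀]
  have hv1 : ∀ x : Site 2, (x + v₀) 1 = x 1 - 2 * M := fun x => by simp [hv₀]; ring
  have hm : ((M - 1 : ℕ) : ℤ) = (M : ℤ) - 1 := by omega
  have hn : ((3 * M - 1 : ℕ) : ℤ) = 3 * (M : ℤ) - 1 := by omega
  rcases tri_hex (M - 1) (3 * M - 1) {x | x + v₀ ∈ (↑S : Set (Site 2))} with
    ⟨x, hx, y, hy, hxy⟩ | ⟨x, hx, y, hy, hxy⟩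
  · -- `S` crosses from the inner to the outer side
    left
    have hP : PathIn triGraph (↑S : Set (Site 2)) (x + v₀) (y + v₀) :=
      pathIn_shift v₀ (fun w hw => hw.2) hxy
    simp only [leftSide, rightSide, Finset.mem_filter, mem_rectangle_iff] at hx hy
    have hxD : x + v₀ ∈ trapD M := hSD (Finset.mem_coe.1 hP.left_mem)
    have hyD : y + v₀ ∈ trapD M := hSD (Finset.mem_coe.1 hP.right_mem)
    refine ⟨x + v₀, ?_, y + v₀, ?_, hP⟩
    · rw [mem_trapI, hv0]; exact ⟨hxD, by omega⟩
    · rw [mem_trapO, hv0]; exact ⟨hyD, by omega⟩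
  · -- a bottom–top path avoiding `S`: it runs in `T ∖ S` until it leaves `T` through `trapU`
    right
    simp only [bottomSide, topSide, Finset.mem_filter, mem_rectangle_iff] at hx hy
    set R : Set (Site 2) :=
      {v | ((M : ℤ) + 1 ≤ v 0 ∧ v 0 ≤ 2 * M ∧ -(2 * (M : ℤ)) ≤ v 1 ∧ v 1 ≤ M - 1) ∧ v ∉ (↑S : Set (Site 2))}
      with hR
    have hP : PathIn triGraph R (x + v₀) (y + v₀) := by
      refine pathIn_shift v₀ (fun w hw => ?_) hxy
      obtain ⟨hw, hwX⟩ := hw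
      rw [Finset.mem_coe, mem_rectangle_iff] at hw
      refine ⟨?_, hwX⟩
      rw [hv0, hv1]
      omega
    have hTS : ∀ v : Site 2, v ∈ trapD M → v ∈ R → v ∈ (↑(trapD M \ S) : Set (Site 2)) := by
      intro v hvD hvR
      rw [Finset.coe_sdiff]
      exact ⟨hvD, hvR.2⟩
    -- the start, on the bottom row, is in `trapB`
    have hpD : x + v₀ ∈ trapD M := by rw [mem_trapD, hv0, hv1]; omega
    have hpB : x + v₀ ∈ trapB M := by rw [mem_trapB, hv1]; exact ⟨hpD, by omega⟩
    rcases hP.exit_or (R := (↑(trapD M) : Set (Site 2))) (Finset.mem_coe.2 hpD) with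
      h | ⟨c, d, hcD, hdD, hdR, hcd, hpc⟩
    · -- it never leaves `T`: its end, on the top row, is the corner of `trapI` and `trapU`
      have hyD : y + v₀ ∈ trapD M := Finset.mem_coe.1 h.right_mem.1
      have hyD' := hyD
      rw [mem_trapD, hv0, hv1] at hyD'
      refine ⟨x + v₀, hpB, y + v₀, ?_, h.mono fun v hv => hTS v hv.1 hv.2⟩
      rw [mem_trapU, hv0, hv1]
      exact ⟨hyD, by omega⟩
    · -- it leaves `T` at `c ∼ d` with `d` in the exterior triangle, so `c ∈ trapU`
      have hcD' : c ∈ trapD M := Finset.mem_coe.1 hcD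
      refine ⟨x + v₀, hpB, c, ?_, hpc.mono fun v hv => hTS v (Finset.mem_coe.1 hv.1) hv.2⟩
      rw [mem_trapU]
      refine ⟨hcD', ?_⟩
      have h1 := hdR.1
      have hcT := mem_trapD.1 hcD'
      have hdT : ¬ (d ∈ trapD M) := fun h' => hdD (Finset.mem_coe.2 h')
      rw [mem_trapD] at hdT
      have h2 := add_le_add_add_one_of_adj hcd
      omega

/-- A path of open sites of the trapezoid from the inner side to the outer side yields a lowest
open crossing of `trapDomain M` (`JDomain.exists_crossing_subset`, `JDomain.lowest_ne_none`). [cite: KestenPTM1982, §2.3 Prop. 2.3] -/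
theorem trapDomain_lowest_ne_none {M : ℕ} {ω : Set (Site 2)} {a z : Site 2} (ha : a ∈ trapI M)
    (hz : z ∈ trapO M) (hp : PathIn triGraph ((↑(trapD M) : Set (Site 2)) ∩ ω) a z) :
    (trapDomain M).lowest ω ≠ none := by
  classical
  obtain ⟨S, hS, hSp, -⟩ := hp.exists_support
  -- the finite set of sites of the path inside `T`
  set S' : Finset (Site 2) := (trapD M).filter fun v => v ∈ S with hS'
  have hcoe : (↑S' : Set (Site 2)) = S := by
    ext v
    simp only [hS', Finset.coe_filter, Set.mem_setOf_eq]
    exact ⟨fun h => h.2, fun h => ⟨Finset.mem_coe.1 (hS h).1, h⟩⟩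
  have hS'D : S' ⊆ (trapDomain M).D := Finset.filter_subset _ _
  obtain ⟨c, w, hc, hcS⟩ := (trapDomain M).exists_crossing_subset hS'D ha hz (hcoe ▸ hSp)
  exact JDomain.lowest_ne_none hc fun v hv => (hS (hcoe ▸ Finset.coe_subset.2 hcS hv)).2

end Literature.Probability.Percolation
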